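import Literature.MathematicalPhysics.QuantumFieldTheory.Balaban1983to89.B5Identities197Torus
import Literature.MathematicalPhysics.QuantumFieldTheory.Balaban1983to89.B5Momentum133
import Literature.MathematicalPhysics.QuantumFieldTheory.Balaban1983to89.B5Blocks16
import Summits.QuantumFields.YangMills.Theorems.BalabanUVNodesN07AliasSumPositivity
import HarnessLib

/-!
# DAG node N07 [B11], road R0′ — LEMMA (P) ONE LEVEL, file 1∕3: Fourier bookkeeping of the CENTRE SAMPLES on the torus `T_η = Tor (fine n M)`
# and the centred aliasing factor `e^{iηp·c₀}·conj u(p) = Π_ν sin((p′_ν+l_ν)∕2)∕(n·sin((p′_ν+l_ν)∕(2n)))` (REAL for odd `n = 2c₀+1`)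

Cell `pub-ymgap` (HUMAN RULINGS D-0062 ∕ D-0149 ∕ D-0154), width seat `pub-ymgap-dag-n07-w5` g0′ (harness re-seat), 2026-08-28.  `--kind proof
--supports <K1 key> --as helper` (count-neutral helper on the N07 [B11] row; CLAIM-1 cell bus 2026-08-28T08:40Z, lane owner dag-n07-e g20 GO 08:46Z).
Steps 1–2 of dag-n07-e's `LOCATED-POINT-FEASIBILITY.md` (block∕coarse Fourier of the centre samples; the aliasing identity) around dag-n07-w7's landed
analytic core `N07AliasSumPositivity.aliasSymbolK_pos` (which file 2∕3 consumes by name).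

THE PRINT.  [B5] = T. Bałaban, *Propagators and renormalization transformations for lattice gauge theories. I*, Commun. Math. Phys. **95** (1984)
17–40 `[Balaban1984PropagatorsI]`: (1.6) p. 18 (blocks), (1.20) p. 20 (`Q′_k`), (1.29)–(1.31) p. 23 («p = p′ + l», `u_k(p) = Π_μ ∂¹_μ(p′)∕∂_μ(p)`,
«u_k(l) = 0 for l ≠ 0»), p. 25 («R … an orthogonal projection on the linear subspace ΔN(Q′_k)»), (1.69)–(1.70) pp. 29–30; [B6] = CMP **96**
(1984) 223–250 `[Balaban1984PropagatorsII]`, (2.10)–(2.12) p. 225, (2.22) p. 226, (2.35) p. 228 («The only assumption we have used was the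
positivity of the operator Δ_a»); [I] = CMP **109** (1987) 249–301 `[Balaban1987RG1]`, (0.4) p. 253 (the averaging of record: block CENTRES, odd `L`).

WHY (road R0′ of record, dag-n07-e `LOCATED-POINT-FEASIBILITY.md`, 2026-08-28).  At the record the (0.4) average intertwines fine gradients with the
coarse gradient of the CENTRE VALUES (`Q_j(1)(∂φ) = ∂_c(φ∘embIter j)`), not with the block means behind `R`; the feasibility of the admissible pure gauge
on road R0′ (`N07FlatHFeasibility.exists_admissible_grad_of_flatKernel`, hypothesis `hker`) is then the lattice lemma
(P) «μ constant on the block centres ∧ R∂*∂μ = 0 ⇒ ∂μ = 0», which print's matched letters never need ([B6] (2.22) is about block means).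

WHAT THIS FILE DOES (by-name composition over the b05 typed torus: `B5Block118` (`pOf`, `chi_pOf_up`, `chi_pOf_iota`, `sum_chi_iota`, `uSym`),
`B5Blocks16` (`bpt_bijective`, `sum_blocks`), `B5Momentum130∕133` (`dft_LapS_apply`, `lsym_pOf`, …), `B5Prop11Fiber` (`dSym`, `vSym`, `dSym_eq_zero_iff`)).
* §1 `sample_eq_sum`, ★ `dft_sample` (the coarse transform of the point samples `y ↦ g(ny + j)` — the point twin of `B5Block118.master`: only the alias
  fibre of `p′` survives), ★ `alias_sum_eq_zero_of_sample_const` (samples constant in `y` kill every coarse mode `p′ ≠ 0`), `QsOp_conjTranspose_mulVec_bpt`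
  (`(Q′ᴴβ)(ny+j) = η^dβ(y)`), ★ `dft_QsOp_conjTranspose_apply` (`(Q′ᴴβ)^(p′+l) = cT·conj u(p′+l)·Σ_y e^{−ip′y}β(y)`), `dft_LapS_LapS_apply`.
* §2 ★★ `centred_factor` (the half-angle identity `e^{icξ}·conj((e^{inξ}−1)∕(n(e^{iξ}−1))) = sin(nξ∕2)∕(n·sin(ξ∕2))` for `n = 2c+1`), `sOf_apply_eq_zero_iff`,
  `shiftr_div_mem`, `sin_shiftr_div_ne_zero` (the removable singularity is the only zero), ★★ `om_pow_mul_conj_vSym` (`ω_ν^{c₀}·conj v_ν(p′+l)` = that real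
  number off the singularity), `om_pow_mul_conj_vSym_zero` (`= 1` at `p′_ν = l_ν = 0`), `om_pow_mul_conj_vSym_eq_zero` (`= 0` at `p′_ν = 0 ≠ l_ν`).

HONEST FRAMING (binding).  Count-neutral helper typed on the b05 owner's torus `Tor (fine n M)` (carrier FN), ONE averaging level (block side `n` odd,
true centres `ny + c₀`, `2c₀ + 1 = n`), every `d`, every unit torus `M`; finite Fourier analysis + trigonometry only.  It asserts NOTHING of
[B11]∕[B6]∕[3]'s analysis; the MULTI-LEVEL lemma `(P)_D` for a nested family `D` (the record's heart family `Node00.cubeDomains`) is NOT proved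
here and remains OPEN (dag-n07-w7's `LOCATED-PD-TILE-CRITERION.md` holds the located evidence); under road (a) of the K0 lineage (k0-s1-w1) `(P)` is
not consumed — this is located-research insurance for the R0′-native junction.  The V1 ∕ record reading needs r03's transports
(`B6ProjR212TorusBridge.RE_bridge` for `R`, `B5Eq147TorusBridge.Lap_tS` ∕ `B5HkOpLandauMin.LapS_towerE` for `Δ`, and the images of the centres) and is
NOT in this file.  `hker` ∕ stub 1 ∕ K0⁷ ∕ K1⁸ NOT closed; N07 NOT discharged; counts unmoved; no summit statement is proved by this seat — R4 closes the
conditional finite-𝕋⁴ rung `BalabanLadder.UV` only; nothing continuum ∕ ℝ⁴ ∕ OS ∕ mass gap ∕ Clay.  No `sorry`, no `def`, no `instance`, no `notation`.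
-/

noncomputable section

open scoped BigOperators Matrix ComplexConjugate
open Finset Complex

namespace Summit.QuantumFields.YangMills.BalabanUVNodes.N07PointFeasibilityOneLevel

open Literature.MathematicalPhysics.QuantumFieldTheory.Balaban1983to89
open B5Prop11Plancherel (Tor chi dft fine sOf chi_add_right chi_zero_left sum_chi conj_chi)
open B5Block118 (cT dft_apply' conj_dft dft_inversion sum_conj_chi_mul_chi up iota bpt pOf pOf_bijective
  pOf_injective om chi_pOf_up chi_pOf_iota avg_om sum_chi_iota uSym_sOf_zero QsOp QsOp_mulVec)
open B5Blocks16 (bpt_bijective bpt_injective sum_blocks)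
open B5Prop11Fiber (dSym d1Sym vSym uSym dSym_eq_zero_iff)
open B5Action121 (LapS GradOp sdiff sdiff_mulVec GradOp_mulVec)
open B5LaplaceInverse (lsym ssym Pker LapSinv)
open B5Momentum130 (dft_LapS_apply lsym_eq_zero_iff dft_zero_apply)
open B5Momentum133 (ssym_pOf lsym_pOf lsym_pOf_ne_zero)
open B5FiberZero (pOf_zero)
open B5Identities197Torus (RT)
open Summit.QuantumFields.YangMills.Theorems.N07AliasSumPositivity (aliasSymbolK_pos)

/-! ## §1  Fourier bookkeeping on the fine torus `T_η = Tor (fine n M)`: point samples and `Q′ᴴ` -/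

section Fourier

variable {d : ℕ} (n : ℕ) [NeZero n] (M : Fin d → ℕ) [hM : ∀ μ, NeZero (M μ)]

omit hM in
/-- `cT > 0`. [folklore] -/
theorem cT_pos (N : Fin d → ℕ) [∀ μ, NeZero (N μ)] : 0 < cT N := by
  unfold cT
  exact inv_pos.mpr (Real.sqrt_pos.mpr (by exact_mod_cast Fintype.card_pos))

/-- Fourier inversion of a point sample along the coset parametrisation `p = p′ + l`:
`g(ny + j) = Σ_{(k,q)} cT · e^{ip′·y} · e^{i(p′+l)·ηj} · ĝ(p′+l)`. [folklore] -/
theorem sample_eq_sum (g : Tor (fine n M) → ℂ) (y : Tor M) (j : Fin d → Fin n) :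
    g (bpt n M y j) = ∑ kq : (Fin d → Fin n) × Tor M,
      (cT (fine n M) : ℂ) * (chi M kq.2 y * chi (fine n M) (pOf n M kq) (iota n M j)) *
        (dft (fine n M) *ᵥ g) (pOf n M kq) := by
  rw [dft_inversion (fine n M) g (bpt n M y j),
    ← (pOf_bijective n M).sum_comp
      (fun p => conj (dft (fine n M) p (bpt n M y j)) * (dft (fine n M) *ᵥ g) p)]
  refine Finset.sum_congr rfl fun kq _ => ?_
  rcases kq with ⟨k, q⟩
  simp only
  rw [conj_dft, bpt, chi_add_right, chi_pOf_up]

/-- **Coarse transform of the point samples `y ↦ g(ny + j)`** (the point twin of `B5Block118.master`):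
`Σ_y F¹_{q,y} g(ny + j) = cT_M·cT_η·|T₁| · Σ_k e^{i(p′+l)·ηj} ĝ(p′+l)` — only the alias fibre of `q` survives. [folklore] -/
theorem dft_sample (g : Tor (fine n M) → ℂ) (j : Fin d → Fin n) (q : Tor M) :
    ∑ y, dft M q y * g (bpt n M y j)
      = ((cT M : ℂ) * (cT (fine n M) : ℂ) * (Fintype.card (Tor M) : ℂ)) *
        ∑ k : Fin d → Fin n, chi (fine n M) (pOf n M (k, q)) (iota n M j) *
          (dft (fine n M) *ᵥ g) (pOf n M (k, q)) := by
  calc ∑ y, dft M q y * g (bpt n M y j)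
      = ∑ y, ∑ kq : (Fin d → Fin n) × Tor M, dft M q y *
          ((cT (fine n M) : ℂ) * (chi M kq.2 y * chi (fine n M) (pOf n M kq) (iota n M j)) *
            (dft (fine n M) *ᵥ g) (pOf n M kq)) := by
        refine Finset.sum_congr rfl fun y _ => ?_
        rw [sample_eq_sum n M g y j, Finset.mul_sum]
    _ = ∑ kq : (Fin d → Fin n) × Tor M, ∑ y, dft M q y *
          ((cT (fine n M) : ℂ) * (chi M kq.2 y * chi (fine n M) (pOf n M kq) (iota n M j)) *
            (dft (fine n M) *ᵥ g) (pOf n M kq)) := Finset.sum_comm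
    _ = ∑ kq : (Fin d → Fin n) × Tor M, (cT (fine n M) : ℂ) * chi (fine n M) (pOf n M kq) (iota n M j) *
          (dft (fine n M) *ᵥ g) (pOf n M kq) * (∑ y, dft M q y * chi M kq.2 y) := by
        refine Finset.sum_congr rfl fun kq _ => ?_
        rw [Finset.mul_sum]
        refine Finset.sum_congr rfl fun y _ => ?_
        ring
    _ = ∑ kq : (Fin d → Fin n) × Tor M, (cT (fine n M) : ℂ) * chi (fine n M) (pOf n M kq) (iota n M j) *
          (dft (fine n M) *ᵥ g) (pOf n M kq) *
          ((cT M : ℂ) * (if kq.2 = q then (Fintype.card (Tor M) : ℂ) else 0)) := by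
        refine Finset.sum_congr rfl fun kq _ => ?_
        congr 1
        rw [← sum_conj_chi_mul_chi, Finset.mul_sum]
        refine Finset.sum_congr rfl fun y _ => ?_
        rw [dft_apply', mul_assoc]
    _ = ((cT M : ℂ) * (cT (fine n M) : ℂ) * (Fintype.card (Tor M) : ℂ)) *
        ∑ k : Fin d → Fin n, chi (fine n M) (pOf n M (k, q)) (iota n M j) *
          (dft (fine n M) *ᵥ g) (pOf n M (k, q)) := by
        rw [Fintype.sum_prod_type, Finset.mul_sum]
        refine Finset.sum_congr rfl fun k _ => ?_
        rw [Finset.sum_eq_single q]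
        · rw [if_pos rfl]
          ring
        · intro q' _ hq'
          rw [if_neg hq']
          ring
        · intro h
          exact absurd (Finset.mem_univ q) h

/-- **Samples constant in `y` kill every non-zero coarse mode**: if `g(ny + j)` does not depend on `y`, then for
every `q ≠ 0` the alias sum `Σ_k e^{i(p′+l)·ηj} ĝ(p′+l)` vanishes. [folklore] -/
theorem alias_sum_eq_zero_of_sample_const (g : Tor (fine n M) → ℂ) (j : Fin d → Fin n)
    (hconst : ∀ y, g (bpt n M y j) = g (bpt n M 0 j)) {q : Tor M} (hq : q ≠ 0) :
    ∑ k : Fin d → Fin n, chi (fine n M) (pOf n M (k, q)) (iota n M j) *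
      (dft (fine n M) *ᵥ g) (pOf n M (k, q)) = 0 := by
  have h := dft_sample n M g j q
  have hL : ∑ y, dft M q y * g (bpt n M y j) = 0 := by
    simp_rw [hconst]
    rw [← Finset.sum_mul]
    have hs : ∑ y, dft M q y = 0 := by
      simp_rw [dft_apply', conj_chi]
      rw [← Finset.mul_sum, sum_chi]
      rw [if_neg (neg_ne_zero.mpr hq), mul_zero]
    rw [hs, zero_mul]
  rw [hL] at h
  have hc : ((cT M : ℂ) * (cT (fine n M) : ℂ) * (Fintype.card (Tor M) : ℂ)) ≠ 0 := by
    have h1 : (cT M : ℂ) ≠ 0 := by exact_mod_cast (cT_pos M).ne'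
    have h2 : (cT (fine n M) : ℂ) ≠ 0 := by exact_mod_cast (cT_pos (fine n M)).ne'
    have h3 : (Fintype.card (Tor M) : ℂ) ≠ 0 := by exact_mod_cast Fintype.card_ne_zero
    exact mul_ne_zero (mul_ne_zero h1 h2) h3
  exact (mul_eq_zero.mp h.symm).resolve_left hc

/-- The transpose of the block average: `(Q′ᴴ β)(ny + j) = η^d β(y)` (each fine site lies in exactly one block).
[cite: Balaban1984PropagatorsI, (1.20) p.20] -/
theorem QsOp_conjTranspose_mulVec_bpt (β : Tor M → ℂ) (y : Tor M) (j : Fin d → Fin n) :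
    ((QsOp n M)ᴴ *ᵥ β) (bpt n M y j) = 1 / (n : ℂ) ^ d * β y := by
  have hQ : ∀ y', QsOp n M y' (bpt n M y j) = if y' = y then 1 / (n : ℂ) ^ d else 0 := by
    intro y'
    simp only [QsOp]
    by_cases hy : y' = y
    · subst hy
      rw [if_pos rfl, Finset.sum_eq_single j]
      · rw [if_pos rfl]
      · intro j' _ hj'
        rw [if_neg]
        intro h
        have h2 := bpt_injective n M (a₁ := (y', j)) (a₂ := (y', j')) h
        exact hj' (congrArg Prod.snd h2).symm
      · intro h
        exact absurd (Finset.mem_univ j) h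
    · rw [if_neg hy]
      refine Finset.sum_eq_zero fun j' _ => ?_
      rw [if_neg]
      intro h
      have h2 := bpt_injective n M (a₁ := (y, j)) (a₂ := (y', j')) h
      exact hy (congrArg Prod.fst h2).symm
  simp only [Matrix.mulVec, dotProduct, Matrix.conjTranspose_apply, hQ]
  rw [Finset.sum_eq_single y]
  · rw [if_pos rfl]
    simp
  · intro y' _ hy'
    rw [if_neg hy', star_zero, zero_mul]
  · intro h
    exact absurd (Finset.mem_univ y) h

/-- **Momentum representation of `Q′ᴴ`** (the transpose of `B5Block118.dft_QsOp`):
`(Q′ᴴ β)^(p′ + l) = cT_η · conj u(p′+l) · Σ_y e^{−ip′·y} β(y)`. [cite: Balaban1984PropagatorsI, (1.30) p.23] -/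
theorem dft_QsOp_conjTranspose_apply (β : Tor M → ℂ) (k : Fin d → Fin n) (q : Tor M) :
    (dft (fine n M) *ᵥ ((QsOp n M)ᴴ *ᵥ β)) (pOf n M (k, q))
      = (cT (fine n M) : ℂ) * conj (uSym n k (sOf M q)) * ∑ y, conj (chi M q y) * β y := by
  have hnc : (n : ℂ) ≠ 0 := by exact_mod_cast NeZero.ne n
  have h1 : (dft (fine n M) *ᵥ ((QsOp n M)ᴴ *ᵥ β)) (pOf n M (k, q))
      = ∑ x, dft (fine n M) (pOf n M (k, q)) x * ((QsOp n M)ᴴ *ᵥ β) x := rfl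
  rw [h1, sum_blocks n M]
  simp_rw [QsOp_conjTranspose_mulVec_bpt, dft_apply', bpt, chi_add_right, map_mul, chi_pOf_up]
  have hsum : ∀ y, ∑ j : Fin d → Fin n, (cT (fine n M) : ℂ) *
      (conj (chi M q y) * conj (chi (fine n M) (pOf n M (k, q)) (iota n M j))) * (1 / (n : ℂ) ^ d * β y)
      = (cT (fine n M) : ℂ) * conj (uSym n k (sOf M q)) * (conj (chi M q y) * β y) := by
    intro y
    have h2 : ∑ j : Fin d → Fin n, conj (chi (fine n M) (pOf n M (k, q)) (iota n M j))
        = (n : ℂ) ^ d * conj (uSym n k (sOf M q)) := by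
      rw [← map_sum, sum_chi_iota, map_mul, map_pow, Complex.conj_natCast]
    calc ∑ j : Fin d → Fin n, (cT (fine n M) : ℂ) *
          (conj (chi M q y) * conj (chi (fine n M) (pOf n M (k, q)) (iota n M j))) * (1 / (n : ℂ) ^ d * β y)
        = (cT (fine n M) : ℂ) * conj (chi M q y) * (1 / (n : ℂ) ^ d * β y) *
            ∑ j : Fin d → Fin n, conj (chi (fine n M) (pOf n M (k, q)) (iota n M j)) := by
          rw [Finset.mul_sum]
          refine Finset.sum_congr rfl fun j _ => ?_
          ring
      _ = (cT (fine n M) : ℂ) * conj (uSym n k (sOf M q)) * (conj (chi M q y) * β y) := by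
          rw [h2]
          field_simp
  simp_rw [hsum]
  rw [← Finset.mul_sum]

/-- `(Δ²μ)^(p) = Δ(p)²·μ̂(p)`. [cite: Balaban1984PropagatorsI, (1.31) p.23] -/
theorem dft_LapS_LapS_apply (μ : Tor (fine n M) → ℂ) (p : Tor (fine n M)) :
    (dft (fine n M) *ᵥ (LapS (fine n M) (n : ℂ) *ᵥ (LapS (fine n M) (n : ℂ) *ᵥ μ))) p
      = lsym (fine n M) (n : ℂ) p ^ 2 * (dft (fine n M) *ᵥ μ) p := by
  rw [dft_LapS_apply, dft_LapS_apply, sq, mul_assoc]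

end Fourier

/-! ## §2  The centred aliasing factor: `e^{iξc₀}·conj v(ξ) = sin(nξ∕2)∕(n·sin(ξ∕2))` is REAL for odd `n = 2c₀+1` -/

section Trig

/-- **The half-angle identity behind the centre sampling** (pure complex analysis): for `n = 2c+1` and `sin(ξ∕2) ≠ 0`,
`e^{icξ} · conj((e^{inξ} − 1)∕(n(e^{iξ} − 1))) = sin(nξ∕2)∕(n·sin(ξ∕2))` — the phase `e^{icξ}` of the block CENTRE cancels the phase of the
corner-anchored geometric sum exactly when `c = (n−1)∕2`, i.e. for ODD `n`. [cite: Balaban1987RG1, (0.4) p.253 (centres of blocks); folklore] -/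
theorem centred_factor (c : ℕ) {n : ℕ} (hn : 2 * c + 1 = n) (ξ : ℝ) (hsin : Real.sin (ξ / 2) ≠ 0) :
    Complex.exp ((ξ : ℂ) * I) ^ c *
        conj ((Complex.exp ((ξ : ℂ) * I) ^ n - 1) / ((n : ℂ) * (Complex.exp ((ξ : ℂ) * I) - 1)))
      = ((Real.sin ((n : ℝ) * ξ / 2) / ((n : ℝ) * Real.sin (ξ / 2)) : ℝ) : ℂ) := by
  subst hn
  -- half-angle variable
  set z : ℂ := Complex.exp (((ξ / 2 : ℝ) : ℂ) * I) with hz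
  have hz0 : z ≠ 0 := Complex.exp_ne_zero _
  have hω : Complex.exp ((ξ : ℂ) * I) = z ^ 2 := by
    rw [hz, ← Complex.exp_nat_mul]
    congr 1
    push_cast
    ring
  have hconjz : conj z = z⁻¹ := by
    rw [hz, ← Complex.exp_conj, ← Complex.exp_neg, map_mul, Complex.conj_ofReal, Complex.conj_I]
    congr 1
    ring
  -- sines through `z`
  have hsin1 : ((Real.sin (ξ / 2) : ℝ) : ℂ) = (z⁻¹ - z) * I / 2 := by
    rw [Complex.ofReal_sin, Complex.sin, hz, ← Complex.exp_neg]
    congr 2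
    · congr 1; push_cast; ring
  have hsinn : ((Real.sin (((2 * c + 1 : ℕ) : ℝ) * ξ / 2) : ℝ) : ℂ)
      = ((z⁻¹) ^ (2 * c + 1) - z ^ (2 * c + 1)) * I / 2 := by
    rw [Complex.ofReal_sin, Complex.sin, hz, ← Complex.exp_neg, ← Complex.exp_nat_mul, ← Complex.exp_nat_mul]
    congr 2
    · congr 1
      · congr 1; push_cast; ring
      · congr 1; push_cast; ring
  have hz2 : 1 - z ^ 2 ≠ 0 := by
    intro h
    apply hsin
    have h' : z⁻¹ - z = 0 := by
      have : z⁻¹ - z = z⁻¹ * (1 - z ^ 2) := by field_simp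
      rw [this, h, mul_zero]
    have : ((Real.sin (ξ / 2) : ℝ) : ℂ) = 0 := by rw [hsin1, h']; simp
    exact_mod_cast this
  have hz2' : z ^ 2 - 1 ≠ 0 := fun h => hz2 (by rw [← neg_sub, h, neg_zero])
  rw [map_div₀, map_sub, map_mul, map_pow, map_sub, map_one, Complex.conj_natCast, hω, map_pow, hconjz,
    Complex.ofReal_div, Complex.ofReal_mul, hsin1, hsinn]
  push_cast
  have hn0 : ((2 * c + 1 : ℕ) : ℂ) ≠ 0 := by exact_mod_cast Nat.succ_ne_zero (2 * c)
  have hn0' : (2 * (c : ℂ) + 1) ≠ 0 := by exact_mod_cast hn0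
  simp only [inv_pow]
  field_simp
  ring

variable {d : ℕ} (n : ℕ) [NeZero n] (M : Fin d → ℕ) [hM : ∀ μ, NeZero (M μ)]

/-- `p′_ν = 0 ↔ q_ν = 0`, one coordinate. [folklore] -/
theorem sOf_apply_eq_zero_iff (q : Tor M) (ν : Fin d) : sOf M q ν = 0 ↔ q ν = 0 := by
  have hM0 : (M ν : ℝ) ≠ 0 := by exact_mod_cast NeZero.ne (M ν)
  unfold sOf
  rw [div_eq_zero_iff, mul_eq_zero, or_iff_left hM0, or_iff_right (mul_ne_zero two_ne_zero Real.pi_ne_zero),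
    Int.cast_eq_zero, ZMod.valMinAbs_eq_zero]

omit hM in
/-- the shifted half-angle `(p′_ν + l_ν)∕(2n)` lies in `(−π, π)` for `|p′_ν| ≤ π`, `0 ≤ l_ν ≤ 2π(n−1)`. [folklore] -/
theorem shiftr_div_mem (k : Fin d → Fin n) (s : Fin d → ℝ) (ν : Fin d) (hs : |s ν| ≤ Real.pi) :
    -Real.pi < B4Strip.shiftr n k s ν / (2 * n) ∧ B4Strip.shiftr n k s ν / (2 * n) < Real.pi := by
  have hn1 : (1 : ℝ) ≤ n := by exact_mod_cast Nat.one_le_iff_ne_zero.mpr (NeZero.ne n)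
  have hk : ((k ν : ℕ) : ℝ) + 1 ≤ n := by exact_mod_cast (k ν).isLt
  have hk0 : (0 : ℝ) ≤ ((k ν : ℕ) : ℝ) := by positivity
  have hπ := Real.pi_pos
  have h2n : (0 : ℝ) < 2 * n := by positivity
  have habs := abs_le.mp hs
  unfold B4Strip.shiftr
  constructor
  · rw [lt_div_iff₀ h2n]
    nlinarith
  · rw [div_lt_iff₀ h2n]
    nlinarith

omit hM in
/-- `sin((p′_ν + l_ν)∕(2n)) = 0` only at `p′_ν = 0`, `l_ν = 0` (the removable singularity of `v_ν`). [folklore] -/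
theorem sin_shiftr_div_ne_zero (k : Fin d → Fin n) (s : Fin d → ℝ) (ν : Fin d) (hs : |s ν| ≤ Real.pi)
    (h : ¬ (s ν = 0 ∧ k ν = 0)) : Real.sin (B4Strip.shiftr n k s ν / (2 * n)) ≠ 0 := by
  obtain ⟨h1, h2⟩ := shiftr_div_mem n k s ν hs
  rw [Ne, Real.sin_eq_zero_iff_of_lt_of_lt h1 h2, div_eq_zero_iff, not_or]
  refine ⟨?_, mul_ne_zero two_ne_zero (Nat.cast_ne_zero.mpr (NeZero.ne n))⟩
  intro h0
  apply h
  have habs := abs_le.mp hs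
  have hπ := Real.pi_pos
  unfold B4Strip.shiftr at h0
  by_cases hk : k ν = 0
  · refine ⟨?_, hk⟩
    rw [hk] at h0
    simpa using h0
  · exfalso
    have hk1 : (1 : ℝ) ≤ ((k ν : ℕ) : ℝ) := by
      exact_mod_cast Nat.one_le_iff_ne_zero.mpr (fun h' => hk (Fin.ext h'))
    nlinarith

/-- **THE CENTRED ALIASING FACTOR, off the removable singularity**: for odd `n = 2c₀+1`, every coarse class `q`, offset `l`
and direction `ν` with `(p′_ν, l_ν) ≠ (0,0)`:
`ω_ν^{c₀} · conj v_ν(p′+l) = sin((p′_ν+l_ν)∕2) ∕ (n·sin((p′_ν+l_ν)∕(2n)))` — a REAL number (`ω_ν = e^{iη(p′_ν+l_ν)}`, `v_ν` of [B5] (1.61)).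
[cite: Balaban1984PropagatorsI, (1.61) p.28; Balaban1987RG1, (0.4) p.253] -/
theorem om_pow_mul_conj_vSym (c : ℕ) (hc : 2 * c + 1 = n) (k : Fin d → Fin n) (q : Tor M) (ν : Fin d)
    (h : ¬ (sOf M q ν = 0 ∧ k ν = 0)) :
    om n k (sOf M q) ν ^ c * conj (vSym n k (sOf M q) ν)
      = ((Real.sin (B4Strip.shiftr n k (sOf M q) ν / 2) /
          ((n : ℝ) * Real.sin (B4Strip.shiftr n k (sOf M q) ν / (2 * n))) : ℝ) : ℂ) := by
  have hn1 : 1 ≤ n := Nat.one_le_iff_ne_zero.mpr (NeZero.ne n)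
  have hnr : (n : ℝ) ≠ 0 := by exact_mod_cast NeZero.ne n
  have hd : dSym n k (sOf M q) ν ≠ 0 := fun h0 =>
    h ((dSym_eq_zero_iff n hn1 k (sOf M q) ν (B5Prop11Plancherel.abs_sOf_le M q ν)).mp h0)
  have hsin := sin_shiftr_div_ne_zero n k (sOf M q) ν (B5Prop11Plancherel.abs_sOf_le M q ν) h
  rw [vSym, if_neg hd, B5Block118.d1Sym_eq_om n k, B5Block118.dSym_eq_om]
  have hξ : om n k (sOf M q) ν = Complex.exp (((B4Strip.shiftr n k (sOf M q) ν / n : ℝ) : ℂ) * I) := rfl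
  have hsin' : Real.sin (B4Strip.shiftr n k (sOf M q) ν / n / 2) ≠ 0 := by
    rw [div_div, mul_comm]; exact hsin
  rw [hξ, centred_factor c hc _ hsin']
  have e1 : (n : ℝ) * (B4Strip.shiftr n k (sOf M q) ν / n) / 2 = B4Strip.shiftr n k (sOf M q) ν / 2 := by
    field_simp
  have e2 : B4Strip.shiftr n k (sOf M q) ν / n / 2 = B4Strip.shiftr n k (sOf M q) ν / (2 * n) := by
    rw [div_div, mul_comm]
  rw [e1, e2]

/-- … and AT the removable singularity (`p′_ν = 0`, `l_ν = 0`): the factor is `1`. [cite: Balaban1984PropagatorsI, (1.61) p.28] -/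
theorem om_pow_mul_conj_vSym_zero (c : ℕ) (k : Fin d → Fin n) (q : Tor M) (ν : Fin d)
    (hs : sOf M q ν = 0) (hk : k ν = 0) :
    om n k (sOf M q) ν ^ c * conj (vSym n k (sOf M q) ν) = 1 := by
  have hn1 : 1 ≤ n := Nat.one_le_iff_ne_zero.mpr (NeZero.ne n)
  have hd : dSym n k (sOf M q) ν = 0 :=
    (dSym_eq_zero_iff n hn1 k (sOf M q) ν (B5Prop11Plancherel.abs_sOf_le M q ν)).mpr ⟨hs, hk⟩
  have hom : om n k (sOf M q) ν = 1 := by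
    have hsh : B4Strip.shiftr n k (sOf M q) ν = 0 := by
      unfold B4Strip.shiftr; rw [hs, hk]; simp
    show Complex.exp (((B4Strip.shiftr n k (sOf M q) ν / n : ℝ) : ℂ) * I) = 1
    rw [hsh]; simp
  rw [vSym, if_pos hd, hom, one_pow, map_one, mul_one]

/-- On a direction with `p′_ν = 0` but `l_ν ≠ 0` the factor VANISHES (`sin(πl_ν) = 0`): only the alias `l_ν = 0` survives there.
[cite: Balaban1984PropagatorsI, (1.31) p.23 («u_k(l) = 0 for l ≠ 0»)] -/
theorem om_pow_mul_conj_vSym_eq_zero (c : ℕ) (hc : 2 * c + 1 = n) (k : Fin d → Fin n) (q : Tor M) (ν : Fin d)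
    (hs : sOf M q ν = 0) (hk : k ν ≠ 0) :
    om n k (sOf M q) ν ^ c * conj (vSym n k (sOf M q) ν) = 0 := by
  rw [om_pow_mul_conj_vSym n M c hc k q ν (fun h => hk h.2)]
  have h0 : Real.sin (B4Strip.shiftr n k (sOf M q) ν / 2) = 0 := by
    have e : B4Strip.shiftr n k (sOf M q) ν / 2 = ((k ν : ℕ) : ℝ) * Real.pi := by
      unfold B4Strip.shiftr; rw [hs]; ring
    rw [e]
    exact Real.sin_nat_mul_pi (k ν : ℕ)
  rw [h0, zero_div, Complex.ofReal_zero]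

end Trig

end Summit.QuantumFields.YangMills.BalabanUVNodes.N07PointFeasibilityOneLevel

end
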